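import Mathlib.MeasureTheory.Integral.Bochner.Basic
import Mathlib.Algebra.Order.Monoid.Units
import Mathlib.Order.SymmDiff
import Literature.Probability.LatticeModels.LatticeGraph
import Literature.Probability.LatticeModels.Correlations
import Literature.Probability.LatticeModels.IsingModel
import Literature.Probability.LatticeModels.IsingThermodynamics
import Literature.Probability.LatticeModels.RandomCurrents
import HarnessLib

-- provenance: harness21/H21/H21/Statements/CritIsing/CorrelationInequalities.lean @ 78ca55e (interim HEAD d8f2665); M5 mechanical rewrite
/-!
# Critical Ising family (`crit-ising`): correlation inequalities and random currents

Statement file of trunk G02 (T-STATMECH) for the family `crit-ising`, on the ferromagnetic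
nearest-neighbour Ising model on a locally finite graph `G` (finite-volume Gibbs measures
`isingMeasure G Λ β h bc` of the prelude) and on `ℤ^d` (`zdGraph d`, infinite-volume states
`twoPointPlus`, `twoPointFree`).

## Covered statement ids

* **crit-ising.S19** — correlation inequalities in finite volume: GKS I (`gks_one`,
  `⟨σ_A⟩ ≥ 0`) and GKS II (`gks_two`, `⟨σ_A σ_B⟩ ≥ ⟨σ_A⟩⟨σ_B⟩`) for the free and `+`
  boundary conditions with `β, h ≥ 0`; the FKG inequality (`ising_fkg`) for increasing
  observables, any boundary condition and any field; Lebowitz' inequality `U₄ ≤ 0`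
  (`lebowitz`); the Messager–Miracle-Solé monotonicity of the two-point function
  (`messager_miracleSole`, `messager_miracleSole_diag`); the Simon–Lieb inequality
  (`simon_lieb`) (Griffiths 1967; Kelly–Sherman 1968; Fortuin–Kasteleyn–Ginibre 1971;
  Lebowitz 1974; Messager–Miracle-Solé 1977; Simon 1980; Lieb 1980; Friedli–Velenik 2017,
  §3.6, §3.8, §3.10).
* **crit-ising.S21** (definition role: random-current representation) — attached to the
  contentful characterisations `isingCorr_eq_currentSum_ratio`
  (`⟨σ_A⟩^∅_{G;β,0} = ∑_{∂n = A} w_β(n) / ∑_{∂n = ∅} w_β(n)`), the switching lemma for a pair of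
  sources `switching_lemma_pair`, and the double-current identity
  `⟨σ_x σ_y⟩² = P^∅ ⊗ P^∅[x ⟷ y in n₁ + n₂]` (`twoPoint_sq_eq_doubleCurrent_conn`)
  (Griffiths–Hurst–Sherman 1970; Aizenman 1982, §§2–3; Duminil-Copin 2016, eq. (2.2),
  Lemma 2.2, Cor. 2.3). All three are proved from the prelude `Literature.Prelude.StatMech.RandomCurrents`.

## Design choices

* All objects (`isingMeasure`, `isingExpect`, `isingCorr`, `isingTwoPoint`, `connectedFour`,
  `spinAt`, `twoPointPlus`, `twoPointFree`, `innerBoundary`, `currentSum`, `pairWeight`,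
  `doubleCurrentMeasure`, `tracedConn`) come from the accepted `Literature.Prelude.StatMech` files; this
  file only states theorems about them, in the namespace `Literature.CritIsing`.
* Finite-volume statements are made for a general simple graph `G` with `[DecidableEq V]
  [G.LocallyFinite]` (the generality of `isingMeasure`; the coupling constants are all `1`, i.e.
  ferromagnetic); the random-current statements need a finite graph,
  `[Fintype V] [DecidableRel G.Adj]`, as in the prelude.
* Free-boundary junk (outline P5): for `bc = free` the spins off `Λ` are frozen to `1`, so every
  finite-volume statement about `⟨σ_A⟩` carries `A ⊆ Λ` (for Lebowitz: all four points in `Λ`).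
* GKS II is stated with the symmetric difference `A ∆ B` (`σ_A σ_B = σ_{A ∆ B}` since
  `σ_x² = 1`), GKS I/II for `bc ∈ {free, +}` as the hypothesis `bc = .free ∨ bc = .plus`.
* FKG: increasing observables are Mathlib `Monotone` functions for the Pi order on
  `SpinConfig V = V → ℤˣ` induced by Mathlib's `LinearOrder ℤˣ`
  (`Mathlib/Algebra/Order/Monoid/Units.lean`). The observables are assumed `Measurable`: for
  uncountable `V` a non-measurable integrand has Bochner-junk expectation `0` (see
  `integral_isingMeasure`), which would make the inequality false (e.g. `g = -1/f`). No
  boundedness hypothesis is needed: every measurable real function is integrable against the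
  finitely supported measure `isingMeasure G Λ β h bc`.
* Messager–Miracle-Solé is stated for the infinite-volume plus state two-point function
  `twoPointPlus d β` at `h = 0` (outline), in the two forms used in practice: monotonicity along
  a coordinate axis in the half-space `0 ≤ x i`, and monotonicity under the diagonal move
  `x ↦ x + eᵢ - eⱼ` when `x j ≤ x i` (reflection through the diagonal hyperplane
  `xᵢ - xⱼ = xᵢ - xⱼ + 1`).
* Simon–Lieb is stated in the outline's fixed shape (§3): free infinite-volume state
  `twoPointFree`, finite-volume free factor `⟨σ₀ σ_y⟩^∅_Λ` on the inner vertex boundary of `Λ`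
  (this is Lieb's form of Simon's inequality; `⟨σ_y σ_x⟩ = twoPointFree d β (x - y)` by
  translation invariance of the free state).
* `isingCorr_eq_currentSum_ratio` (no sign hypothesis on `β`) and
  `twoPoint_sq_eq_doubleCurrent_conn` (`0 ≤ β`) are stated exactly as proved in the prelude
  (the outline's `0 < β` is not needed).

## Mathlib status

Mathlib has no Ising model, no GKS/FKG/Lebowitz/Simon–Lieb inequalities and no random currents
(searched: `Ising`, `GKS`, `Griffiths`, `FKG`, `Lebowitz`, `fourFunction`, `Holley`,
`randomCurrent`, `switching`). Mathlib does have the abstract four-functions / Ahlswede–Daykin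
theorem (`Mathlib/Combinatorics/SetFamily/FourFunctions.lean`, `Finset.four_functions_theorem`,
`holley`, `fkg` for finite distributive lattices), which is the combinatorial core of a proof of
`ising_fkg` but not the measure-theoretic statement made here. Anchors used: `Monotone`,
`Measurable`, `symmDiff` (`∆`), `Pi.single`, `Measure.real`, `tsum`.

## References

* R. B. Griffiths, *Correlations in Ising ferromagnets I, II*, J. Math. Phys. 8 (1967) 478–483,
  484–489.
* D. G. Kelly, S. Sherman, *General Griffiths' inequalities on correlations in Ising
  ferromagnets*, J. Math. Phys. 9 (1968) 466–484.
* C. M. Fortuin, P. W. Kasteleyn, J. Ginibre, *Correlation inequalities on some partially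
  ordered sets*, Comm. Math. Phys. 22 (1971) 89–103.
* J. L. Lebowitz, *GHS and other inequalities*, Comm. Math. Phys. 35 (1974) 87–92.
* A. Messager, S. Miracle-Solé, *Correlation functions and boundary conditions in the Ising
  ferromagnet*, J. Stat. Phys. 17 (1977) 245–262.
* B. Simon, *Correlation inequalities and the decay of correlations in ferromagnets*, Comm.
  Math. Phys. 77 (1980) 111–126; E. H. Lieb, *A refinement of Simon's correlation inequality*,
  Comm. Math. Phys. 77 (1980) 127–135.
* R. B. Griffiths, C. A. Hurst, S. Sherman, J. Math. Phys. 11 (1970) 790–795.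
* M. Aizenman, *Geometric analysis of φ⁴ fields and Ising models*, Comm. Math. Phys. 86 (1982)
  1–48, §§2–3.
* H. Duminil-Copin, *Random currents expansion of the Ising model*, arXiv:1607.06933 (2016),
  §2, eq. (2.2), Lemma 2.2, Corollary 2.3.
* S. Friedli, Y. Velenik, *Statistical Mechanics of Lattice Systems* (CUP 2017), §3.6 (GKS,
  FKG), §3.8, §3.10.
-/

noncomputable section

open MeasureTheory Finset Literature.Probability.LatticeModels Literature.Probability.Percolation
open scoped symmDiff

namespace Literature.Probability.LatticeModels

/-! ### crit-ising.S19 — GKS, FKG and Lebowitz in finite volume -/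

section FiniteVolume

variable {V : Type*} (G : SimpleGraph V) [DecidableEq V] [G.LocallyFinite]
variable {Λ A B : Finset V} {β h : ℝ} {bc : BoundaryCondition V}

/-- **crit-ising.S19** (first Griffiths (GKS I) inequality; Griffiths, J. Math. Phys. 8 (1967)
478; Kelly–Sherman 1968; Friedli–Velenik 2017, Thm. 3.20 / eq. (3.21)).
For the ferromagnetic Ising model in the finite volume `Λ` with free or `+` boundary condition,
`β ≥ 0` and `h ≥ 0`: `⟨σ_A⟩_{Λ;β,h}^{bc} ≥ 0` for every `A ⊆ Λ`. [cite: KellySherman1968] -/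
def gks_one : Prop :=
  ∀ (hβ : 0 ≤ β) (hh : 0 ≤ h) (hbc : bc = .free ∨ bc = .plus) (hA : A ⊆ Λ),
    0 ≤ isingCorr G Λ β h bc A

/-- **crit-ising.S19** (second Griffiths (GKS II) inequality; Griffiths, J. Math. Phys. 8
(1967) 484; Kelly–Sherman 1968; Friedli–Velenik 2017, Thm. 3.20 / eq. (3.22)).
For the ferromagnetic Ising model in the finite volume `Λ` with free or `+` boundary condition,
`β ≥ 0` and `h ≥ 0`: `⟨σ_A σ_B⟩ ≥ ⟨σ_A⟩ ⟨σ_B⟩` for all `A, B ⊆ Λ`; here `σ_A σ_B = σ_{A ∆ B}`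
since `σ_x² = 1`. [cite: KellySherman1968] -/
def gks_two : Prop :=
  ∀ (hβ : 0 ≤ β) (hh : 0 ≤ h) (hbc : bc = .free ∨ bc = .plus) (hA : A ⊆ Λ) (hB : B ⊆ Λ),
    isingCorr G Λ β h bc A * isingCorr G Λ β h bc B ≤ isingCorr G Λ β h bc (A ∆ B)

/-- **crit-ising.S19** (FKG inequality; Fortuin–Kasteleyn–Ginibre, Comm. Math. Phys. 22 (1971)
89; Friedli–Velenik 2017, Thm. 3.21).
For the ferromagnetic Ising model in the finite volume `Λ` with `β ≥ 0`, an arbitrary boundary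
condition and an arbitrary field `h ∈ ℝ`, and for all nondecreasing (for the coordinatewise
order `-1 < 1`) measurable observables `f, g`: `⟨f g⟩_{Λ;β,h}^{bc} ≥ ⟨f⟩ ⟨g⟩`. Measurability
excludes the Bochner junk value `0` for non-measurable integrands (only possible for
uncountable `V`); integrability is automatic on the finitely supported Gibbs measure. [cite: FriedliVelenik2017, Thm. 3.21] -/
def ising_fkg : Prop :=
  ∀ (hβ : 0 ≤ β) (Λ : Finset V) (h : ℝ) (bc : BoundaryCondition V) (f g : SpinConfig V → ℝ) (hf : Monotone f) (hg : Monotone g) (hfm : Measurable f) (hgm : Measurable g),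
    isingExpect G Λ β h bc f * isingExpect G Λ β h bc g ≤ isingExpect G Λ β h bc (f * g)

/-- **crit-ising.S19** (Lebowitz' inequality; Lebowitz, Comm. Math. Phys. 35 (1974) 87;
Glimm–Jaffe 1987, Cor. 4.3.3; Aizenman 1982, Prop. 5.3).
For the ferromagnetic Ising model in the finite volume `Λ` with free boundary condition, zero
field and `β ≥ 0`, the connected four-point function is non-positive:
`U₄(x₁,x₂,x₃,x₄) = ⟨σ₁σ₂σ₃σ₄⟩ - ⟨σ₁σ₂⟩⟨σ₃σ₄⟩ - ⟨σ₁σ₃⟩⟨σ₂σ₄⟩ - ⟨σ₁σ₄⟩⟨σ₂σ₃⟩ ≤ 0` for all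
`x₁, …, x₄ ∈ Λ`. [cite: GlimmJaffe1987, Cor. 4.3.3] -/
def lebowitz : Prop :=
  ∀ (hβ : 0 ≤ β) (Λ : Finset V) (x : Fin 4 → V) (hx : ∀ i, x i ∈ Λ),
    connectedFour (isingMeasure G Λ β 0 .free) spinAt x ≤ 0

end FiniteVolume

/-! ### crit-ising.S19 — Messager–Miracle-Solé and Simon–Lieb on `ℤ^d` -/

section Lattice

variable {d : ℕ} {β : ℝ}

/-- **crit-ising.S19** (Messager–Miracle-Solé monotonicity along a coordinate axis;
Messager–Miracle-Solé, J. Stat. Phys. 17 (1977) 245; Hegerfeldt, Comm. Math. Phys. 57 (1977)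
259; Friedli–Velenik 2017, §3.10.6).
For the nearest-neighbour Ising model on `ℤ^d` at `β ≥ 0`, `h = 0`, the two-point function
`x ↦ ⟨σ₀ σ_x⟩⁺_β` is non-increasing in the coordinate `xᵢ` on the half-space `xᵢ ≥ 0`:
`⟨σ₀ σ_{x + eᵢ}⟩⁺ ≤ ⟨σ₀ σ_x⟩⁺`. [cite: FriedliVelenik2017, §3.10.6] -/
def messager_miracleSole : Prop :=
  ∀ (hβ : 0 ≤ β) (x : Site d) (i : Fin d) (hx : 0 ≤ x i),
    twoPointPlus d β (x + Pi.single i 1) ≤ twoPointPlus d β x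

/-- **crit-ising.S19** (Messager–Miracle-Solé monotonicity, diagonal reflections;
Messager–Miracle-Solé, J. Stat. Phys. 17 (1977) 245; Hegerfeldt, Comm. Math. Phys. 57 (1977)
259).
For the nearest-neighbour Ising model on `ℤ^d` at `β ≥ 0`, `h = 0`, and `i ≠ j` with
`xⱼ ≤ xᵢ`, moving `x` away from the diagonal hyperplane decreases the two-point function:
`⟨σ₀ σ_{x + eᵢ - eⱼ}⟩⁺ ≤ ⟨σ₀ σ_x⟩⁺` (reflection through `{yᵢ - yⱼ = xᵢ - xⱼ + 1}`, which
separates neither `0` nor `x` from the other). [cite: MessagerMiracleSoleJSP1977, main theorem (monotonicity of ⟨σ₀σ_x⟩ under reflections)] -/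
def messager_miracleSole_diag : Prop :=
  ∀ (hβ : 0 ≤ β) (x : Site d) {i j : Fin d} (hij : i ≠ j) (hx : x j ≤ x i),
    twoPointPlus d β (x + Pi.single i 1 - Pi.single j 1) ≤ twoPointPlus d β x

/-- **crit-ising.S19** (Simon–Lieb inequality; Simon, Comm. Math. Phys. 77 (1980) 111, Thm.;
Lieb, Comm. Math. Phys. 77 (1980) 127; Friedli–Velenik 2017, §3.10; outline §3 fixed shape).
For the nearest-neighbour Ising model on `ℤ^d` at `β ≥ 0`, `h = 0`, a finite `Λ ∋ 0` and
`x ∉ Λ`, the free-state two-point function satisfies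
`⟨σ₀ σ_x⟩^∅ ≤ ∑_{y ∈ ∂ⁱⁿΛ} ⟨σ₀ σ_y⟩^∅_{Λ;β,0} ⟨σ_y σ_x⟩^∅`, where `⟨σ_y σ_x⟩^∅ = ⟨σ₀ σ_{x-y}⟩^∅`
by translation invariance. [cite: FriedliVelenik2017, §3.10] -/
def simon_lieb : Prop :=
  ∀ (hβ : 0 ≤ β) (Λ : Finset (Site d)) (h0 : (0 : Site d) ∈ Λ) {x : Site d} (hx : x ∉ Λ),
    twoPointFree d β x ≤
      ∑ y ∈ innerBoundary (zdGraph d) Λ,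
        isingTwoPoint (zdGraph d) Λ β 0 .free 0 y * twoPointFree d β (x - y)

end Lattice

/-! ### crit-ising.S21 — the random-current representation -/

section RandomCurrents

variable {V : Type*} [Fintype V] [DecidableEq V] (G : SimpleGraph V) [DecidableRel G.Adj]

/-- **crit-ising.S21** (random-current representation of correlations; Griffiths–Hurst–Sherman,
J. Math. Phys. 11 (1970) 790; Aizenman, Comm. Math. Phys. 86 (1982), §2; Duminil-Copin 2016,
eq. (2.2); prelude `isingCorr_free_eq_currentSum_div`).
For the free-boundary, zero-field Ising model on the finite graph `G`, with currents
`n : E(G) → ℕ`, sources `∂n` and weights `w_β(n) = ∏_e β^{n_e} / n_e!`: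
`⟨σ_A⟩^∅_{G;β,0} = ∑_{∂n = A} w_β(n) / ∑_{∂n = ∅} w_β(n)` for every `A ⊆ V`. [cite: DuminilCopin2016, eq. (2.2] -/
def isingCorr_eq_currentSum_ratio : Prop :=
  ∀ (β : ℝ) (A : Finset V),
    isingCorr G univ β 0 .free A = currentSum G β A / currentSum G β ∅

/- interim proof relied on results that are now named facts (D-0014); demoted to a fact by the M5 import, proof preserved:
:=
  isingCorr_free_eq_currentSum_div G β A
-/

/-- **crit-ising.S21** (switching lemma for a pair of sources; Griffiths–Hurst–Sherman 1970;
Aizenman 1982, Lemma 3.2; Duminil-Copin 2016, Lemma 2.2; two-source specialisation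
`A = {x} ∆ {y}` of the prelude `currentSum_switching`).
For all vertices `x, y` of the finite graph `G` and every bounded `F` on currents,
`∑_{∂n₁ = {x,y}, ∂n₂ = {x,y}} F(n₁ + n₂) w_β(n₁) w_β(n₂)
  = ∑_{∂n₁ = ∅, ∂n₂ = ∅} F(n₁ + n₂) w_β(n₁) w_β(n₂) 1{x ⟷ y in n₁ + n₂}`
(with `{x,y}` read as `{x} ∆ {y}`, so that the diagonal `x = y` is included). [cite: GriffithsHurstSherman1970] -/
def switching_lemma_pair : Prop :=
  ∀ (β : ℝ) (x y : V) (F : Current G → ℝ) (hF : ∃ C, ∀ n, ‖F n‖ ≤ C),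
    ∑' p : Current G × Current G, pairWeight G β ({x} ∆ {y}) ({x} ∆ {y}) p * F (p.1 + p.2) =
      ∑' p : Current G × Current G,
        pairWeight G β ∅ ∅ p * F (p.1 + p.2) * (tracedConn G x y).indicator 1 p

/- interim proof relied on results that are now named facts (D-0014); demoted to a fact by the M5 import, proof preserved:
:= by
  have h := currentSum_switching G β ({x} ∆ {y}) x y F hF
  rwa [symmDiff_self, Finset.bot_eq_empty] at h
-/

/-- **crit-ising.S21** (the traced double-current measure; Aizenman, Comm. Math. Phys. 86
(1982), Prop. 3.1 and §3; Duminil-Copin 2016, Corollary 2.3; prelude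
`isingTwoPoint_free_sq_eq`).
For the free-boundary, zero-field Ising model on the finite graph `G` at `β ≥ 0`, the squared
two-point function is the probability, under the sourceless double-current measure
`P^∅ ⊗ P^∅`, that `x` and `y` are connected in the trace of `n₁ + n₂`:
`⟨σ_x σ_y⟩^∅_{G;β,0}² = P^∅ ⊗ P^∅[x ⟷ y in n₁ + n₂]`. [cite: DuminilCopin2016, Corollary 2.3] -/
def twoPoint_sq_eq_doubleCurrent_conn : Prop :=
  ∀ {β : ℝ} (hβ : 0 ≤ β) (x y : V),
    isingTwoPoint G univ β 0 .free x y ^ 2 =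
      (doubleCurrentMeasure G β ∅ ∅).real (tracedConn G x y)

/- interim proof relied on results that are now named facts (D-0014); demoted to a fact by the M5 import, proof preserved:
:=
  isingTwoPoint_free_sq_eq G hβ x y
-/

end RandomCurrents

end Literature.Probability.LatticeModels
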